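import Literature.MathematicalPhysics.QuantumLattice.HeatKernelGroupConvolutionProofs
import Literature.MathematicalPhysics.QuantumFieldTheory.MullerSchiemann1987.MS87HeatKernelGroup
import HarnessLib

/-!
# Müller–Schiemann, *Continuum limit of a hierarchical SU(2) lattice gauge theory in 4 dimensions*
# (CMP 110, 1987): MIGDAL'S RECURSION (1.1) `(𝒯g)(u) = {g^{*r}(u)/g^{*r}(e₀)}^r` ON A COMPACT GROUP, and
# the iteration of the general properties (2.1)–(2.3) (normalisation, class function, inversion
# symmetry), positivity and continuity, and (v1.1) property (i) of p.283 (sup-norm continuity of `𝒯` on `𝒢`);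
# (2.4)/(3.1) and (v1.1) (3.8), (4.3)–(4.5) on the real slice; (5.1)–(5.3) — PROVED

statement-level skeleton of published theorems with citation tags; proofs where landed; nothing here is a claim about the Yang–Mills mass gap

**Citation header (reproduction of PUBLISHED work).** V. F. Müller, J. Schiemann, *Continuum limit of a hierarchical
SU(2) lattice gauge theory in 4 dimensions*, Commun. Math. Phys. **110** (1987) 261–286, doi 10.1007/BF01207367
[MullerSchiemann1987], Sect. 1 p.262 (1.1), Sect. 2 p.263 (2.1)–(2.4), Sect. 3 p.266 (3.1), Sect. 5 p.275
(5.1)–(5.3), Sect. 6 p.283 L.25–31. The displays were READ ON PAGE IMAGES of the held Project Euclid scan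
`paper:url-96df5da18d4c` (PDF page = journal page − 260) rendered by this seat
(`run/shared/lean/pub/lit-balaban/lit-balaban-p12/renders-cmp110ms/ms87-cmp110-pdfp002/003/006/015/023-*.png`); the
scan's text layer garbles (1.1), (2.4), (3.1), (5.1)–(5.2). The general properties (2.1)–(2.3) and their iteration
are quoted by the paper from its predecessor (I) = [8] = V. F. Müller, J. Schiemann, *Convergence of Migdal–Kadanoff
iterations in non-abelian lattice gauge models*, Commun. Math. Phys. **97** (1985), doi 10.1007/BF01221221 («see
(I): (2.2), (2.5), (2.6)», p.263); the proofs below are the elementary Haar-measure manipulations, written out.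
Eighth file of `MullerSchiemann1987/`; Lean lane of the lit-balaban YM LIT SWEEP CONTEXT row X1 (register level,
zero weight for any token of that table): the model is the `d = 4` HIERARCHICAL `SU(2)` gauge model (Migdal's
recursion as an exact renormalization group), NOT lattice Yang–Mills.

**What the paper prints (verbatim from the page images).**
* (1.1) p.262: *«Hence we investigate a sequence of "Gibbs factors" g⁽ⁿ⁾ on a nonabelian group G recursively
  generated from an initial one by the transformation (𝒯g)(u) = {g^{*r}(u)/g^{*r}(e₀)}^r (1.1) with u, e₀ ∈ G, e₀ the
  unit element. g^{*r} denotes the multiple convolution product of r factors. In the case of a hierarchical gauge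
  model {spin system} r is the number of plaquettes {bonds} united by a block spin transformation, hence the minimal
  value for r is 4 {2}. The equal powers of ordinary and convolution products in (1.1) reflect critical dimension,
  i.e. dimension 4 {2} in gauge models {spin systems}.»*
* p.263 L.29–37 and (2.1)–(2.3): *«In the sequel we consider exclusively the (gauge) group G = SU(2). The Gibbs factor
  attached to a plaquette … after n iterations of the renormalization group transformation is denoted by g⁽ⁿ⁾(u).
  It is a real valued, positive function of u ∈ G and has the following properties, see (I): (2.2), (2.5), (2.6),
  with e₀ the unit element of G and u, v ∈ G, g⁽ⁿ⁾(e₀) = 1, (2.1) g⁽ⁿ⁾(vuv⁻¹) = g⁽ⁿ⁾(u), (2.2) g⁽ⁿ⁾(u⁻¹) = g⁽ⁿ⁾(u),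
  (2.3) valid for n ∈ ℕ₀. Usually g⁽⁰⁾(u) is chosen as a function of positive type; this property iterates too,
  see (I).»*
* (2.4) p.263: *«We first treat Migdal's recursion relation for the simplest critical setting, r = q = 2 in (I):
  (2.10 M), g⁽ⁿ⁺¹⁾(e^{−ixσ₃}u) = (1/𝒩){∫ dv g⁽ⁿ⁾(e^{−(i/2)xσ₃}uv⁻¹) g⁽ⁿ⁾(e^{−(i/2)xσ₃}v)}². (2.4)»*; (2.6) p.264:
  *«g̃⁽ⁿ⁾(u, x) = g⁽ⁿ⁾(e^{−ixσ₃}u)»* (the paper then continues (2.4) analytically in `x`).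
* (3.1) p.266: *«The functions g̃⁽ⁿ⁾(u, z), (2.7), are inductively defined by the analytically continued recursion
  relation (2.4) of Migdal, g̃⁽ⁿ⁺¹⁾(u, z) = (1/𝒩){∫ dv g̃⁽ⁿ⁾(uv⁻¹, z/2) g̃⁽ⁿ⁾(v, z/2)}². (3.1)»*
* (5.1)–(5.3) p.275: *«From (3.1) we have the recursion relation g̃′(u, iy) = {J(u, iy)/M}² (5.1) with the
  convolutions J(u, iy) = ∫ dv g̃(uv⁻¹, (i/2)y) g̃(v, (i/2)y), (5.2) M = ∫ dv [g(v)]². (5.3)»*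
* p.283 L.25–31: *«The final steps of our proof rely on two general properties of the Migdal transformation 𝒯,
  namely (i) 𝒯 is continuous (with respect to the supremum norm) on 𝒢 := {g(u) continuous class function on G,
  g(u) ≥ 0, g(e₀) = 1}, and (ii) 𝒯 is injective on 𝒢₀ := {g ∈ 𝒢, g is of positive type}. Both (i) and (ii) are
  deduced from properties of [𝒯g]^{1/r}, invoking for (ii) the character expansion of g.»*

**What is formalized here (kernel-checked, zero `sorry`, zero named facts).** On an arbitrary compact Hausdorff
group `G` with its Haar probability measure `dv` (`haarProbability G`; the convolution is the tree's
`QuantumLattice.haarConv`, `(k ⋆ f)(u) = ∫ k(v) f(v⁻¹u) dv = ∫ k(uv⁻¹) f(v) dv`):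
* `convPow g n = g^{*(n+1)}` and **`migdal r g = 𝒯g` of (1.1)** (`migdal_apply`); for `r = 2`:
  `𝒯g(u) = {(g ⋆ g)(u)/(g ⋆ g)(e₀)}²` (`migdal_two`).
* The class `InG` = the paper's `𝒢` (p.283) and the predicates `IsCentral` (2.2), `IsSymm` (2.3).
* **(2.1)–(2.3) ITERATE** («valid for n ∈ ℕ₀»): `𝒯g(e₀) = 1` whenever `g^{*r}(e₀) ≠ 0` (`migdal_apply_one`), in
  particular on `𝒢` (`migdal_one_of_inG`); `g` central ⇒ every `g^{*n}` and `𝒯g` central (`isCentral_convPow`,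
  `isCentral_migdal`); `g` central with `g(u⁻¹) = g(u)` ⇒ the same for `g^{*n}` and `𝒯g` (`isSymm_convPow`,
  `isSymm_migdal`); «real valued, positive» iterates (`migdal_pos`); continuity iterates (`continuous_migdal`);
  **`𝒯` maps `𝒢` into `𝒢`** (`inG_migdal`), the denominator being positive on `𝒢` (`convPow_apply_one_pos`:
  `g^{*n}(e₀) > 0` for `g ∈ 𝒢`, by induction from `g(e₀) = 1`, continuity and the positivity of Haar measure on
  open sets).
* **(5.3)**: `(g ⋆ g)(e₀) = ∫ [g(v)]² dv = M` under (2.3) (`haarConv_self_apply_one`), so that the normalisation of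
  (2.4)/(3.1)/(5.1) at zero angle is `𝒩 = M²` and **`𝒯g(u) = {J(u)/M}²`, `J(u) = ∫ g(uv⁻¹) g(v) dv`**
  (`migdal_two_eq_J_div_M_sq` — (5.1)–(5.2) at `y = 0`).
* **(2.4) = (3.1) ON THE REAL SLICE is (1.1)**: for a central `g` and any `a ∈ G`,
  `(g ⋆ g)(a²u) = ∫ g(a u v⁻¹) g(a v) dv` (`haarConv_self_sq_mul` — substitute `v ↦ av` and use (2.2)), hence
  `𝒯g(a²u) = {∫ g(auv⁻¹) g(av) dv / M}²` (`migdal_two_sq_mul`); on `G = SU(2)` with `a = e^{−(i/2)xσ₃}`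
  (`HeatKernel.diagPhase (x/2)`, `a² = e^{−ixσ₃}` by `diagPhase_add`) this is the display (2.4) for REAL `x`
  (`eq24_real`) — whose right side the paper then continues analytically in `x` ((2.6)–(2.7), (3.1)).
* **(v1.1, §8) PROPERTY (i) OF p.283 — «𝒯 is continuous (with respect to the supremum norm) on 𝒢»**:
  `|k ⋆ f − k′ ⋆ f′| ≤ sup|k − k′|·sup|f| + sup|k′|·sup|f − f′|` (`abs_haarConv_sub_haarConv_le`), `|g^{*n}| ≤ (sup|g|)^n`
  (`abs_convPow_le`), `gᵢ → g` uniformly ⇒ `gᵢ^{*n} → g^{*n}` uniformly (`convPow_sub_uniform`), and, dividing by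
  `g^{*r}(e₀) > 0` and taking `r`-th powers on a bounded range, **`gᵢ → g` uniformly in `𝒢` ⇒ `𝒯gᵢ → 𝒯g` uniformly**
  (`migdal_sub_uniform`, `ε`-form along any filter; `tendstoUniformly_migdal`, Mathlib's `TendstoUniformly`).

* **(v1.1, §9) (4.3)–(4.5) ON THE REAL SLICE**: with `N_χ(a) = ∫ χ(v) g(a⁻¹v) g(av) dv` (`numK`; `K = Kfun`
  (4.4), `L = Lfun` (4.5)), `(g ⋆ g)(a²) = ∫ g(a⁻¹v) g(av) dv` ((3.1) at `u = e₀` with (2.9): `haarConv_self_sq`),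
  `N_χ + N_{1−χ} = (g ⋆ g)(a²)` (`numK_add_numK_compl`) and **`𝒯g(a²) = {K(a)(1 + L(a))/(1 + L(e₀))}²`**
  (`eq43_real`) for any integrable weight `χ` with non-vanishing denominators.

* **(v1.1, §10) `r = 4`, (3.8) ON THE REAL SLICE**: `𝒯g = {g^{*4}/g^{*4}(e₀)}⁴` (`migdal_four`), `g^{*4}` as the
  iterated triple integral of (3.8) (`convPow_three_apply`), the substitution `(k ⋆ f)(a^{m+1}u) = ∫ k(auw⁻¹) f(a^m w) dw`
  for central `k` (`haarConv_pow_succ_mul`) and hence **`g^{*4}(a⁴u) = ∫dw₁ g(auw₁⁻¹) ∫dw₂ g(aw₁w₂⁻¹) ∫dw₃ g(aw₂w₃⁻¹) g(aw₃)`**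
  (`eq38_real`; on `SU(2)`, `a = e^{−(i/4)xσ₃}`).

* **(v1.1, §11) THEOREM 3, THE INDUCTIVE STEP (p.283 L.31–37)** in abstract form: `gs j ∈ 𝒢`, every subsequence
  with a uniformly convergent sub-subsequence whose limit lies in a set `S₀ ⊆ 𝒢` on which `𝒯` is injective
  (Theorem 2 part 4) and property (ii) — HYPOTHESES), `𝒯(gs j) → gₙ` uniformly ⇒ `gs → g` uniformly for the unique
  `g ∈ S₀` with `𝒯g = gₙ` (`thm3_inductive_step`; property (i) = `tendstoUniformly_migdal` is what is USED).

**History.** v1.0 (lit-balaban-p12 gen 19, p347599): §1–§7. v1.1 (same seat): + §8, §9, §10, §11, append-only (no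
v1.0 declaration touched; reading (b) updated).

**Readings (declared).** (a) `G` is any compact Hausdorff group (the paper: «a nonabelian group G», then
`G = SU(2)`); `r : ℕ` arbitrary (the paper: `r = 2` or `4`; `migdal 0 g = 1` is a harmless junk case).
(b) «positive type iterates» and property (ii) (injectivity on `𝒢₀`, character expansion) are NOT formalized
((ii) and Theorem 2 part 4) enter `thm3_inductive_step` as hypotheses);
property (i) is formalized (v1.1, §8) as: uniform convergence `gᵢ → g` on `G` within `𝒢` (any filter) implies uniform
convergence `𝒯gᵢ → 𝒯g` (`tendstoUniformly_migdal`). (c) The analytic continuation in the central angle ((2.6)–(2.7), (3.1)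
for complex `z`) is not constructed here; `eq24_real` is the real-`x` identity from which it starts.

**Not claimed.** Theorem 1, Propositions 1–2, Theorems 2–4, anything about lattice Yang–Mills. Related tree file
(different object): `Literature/Barriers/QuantumFields/MigdalKadanoffGroupBlindnessDischarge.lean` (the `U(1)`
recursion on periodic functions, Ito 1985/1987).
-/

noncomputable section

open MeasureTheory Filter Topology
open Literature.MathematicalPhysics.QuantumFieldTheory (haarProbability)
open Literature.MathematicalPhysics.QuantumLattice (haarConv haarConv_apply haarConv_eq_integral_mul_inv
  continuous_haarConv haarConv_comp_mul_right haarConv_comp_mul_left central_apply_mul_inv)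

namespace Literature.MathematicalPhysics.QuantumFieldTheory

namespace MullerSchiemann1987

namespace Migdal

section General

variable {G : Type*} [Group G] [TopologicalSpace G] [IsTopologicalGroup G] [CompactSpace G]
  [MeasurableSpace G] [BorelSpace G]

/-! ### §1. The objects: (2.2), (2.3), `g^{*n}`, (1.1), `𝒢` -/

omit [TopologicalSpace G] [IsTopologicalGroup G] [CompactSpace G] [MeasurableSpace G] [BorelSpace G] in
/-- (2.2): `g(vuv⁻¹) = g(u)` — a class function. [cite: MullerSchiemann1987, (2.2) p.263] -/
def IsCentral (g : G → ℝ) : Prop := ∀ u v : G, g (v * u * v⁻¹) = g u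

omit [TopologicalSpace G] [IsTopologicalGroup G] [CompactSpace G] [MeasurableSpace G] [BorelSpace G] in
/-- (2.3): `g(u⁻¹) = g(u)`. [cite: MullerSchiemann1987, (2.3) p.263] -/
def IsSymm (g : G → ℝ) : Prop := ∀ u : G, g u⁻¹ = g u

/-- The multiple convolution products of (1.1): `convPow g n = g^{*(n+1)}` (`n + 1` factors; Haar probability
measure, `(k ⋆ f)(u) = ∫ k(v) f(v⁻¹u) dv`). [cite: MullerSchiemann1987, (1.1) p.262] -/
def convPow (g : G → ℝ) : ℕ → G → ℝ
  | 0 => g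
  | n + 1 => haarConv g (convPow g n)

/-- `g^{*1} = g`. [cite: MullerSchiemann1987, (1.1) p.262] -/
@[simp] theorem convPow_zero (g : G → ℝ) : convPow g 0 = g := rfl

/-- `g^{*(n+2)} = g ⋆ g^{*(n+1)}`. [cite: MullerSchiemann1987, (1.1) p.262] -/
theorem convPow_succ (g : G → ℝ) (n : ℕ) : convPow g (n + 1) = haarConv g (convPow g n) := rfl

/-- **Migdal's transformation (1.1)**: `(𝒯g)(u) = {g^{*r}(u)/g^{*r}(e₀)}^r`, `r` the number of plaquettes {bonds}
united by the block transformation («the equal powers of ordinary and convolution products … reflect critical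
dimension»). [cite: MullerSchiemann1987, (1.1) p.262] -/
def migdal (r : ℕ) (g : G → ℝ) : G → ℝ :=
  fun u => (convPow g (r - 1) u / convPow g (r - 1) 1) ^ r

/-- Unfolding (1.1). [cite: MullerSchiemann1987, (1.1) p.262] -/
theorem migdal_apply (r : ℕ) (g : G → ℝ) (u : G) :
    migdal r g u = (convPow g (r - 1) u / convPow g (r - 1) 1) ^ r := rfl

/-- (1.1) for `r = 2` («the simplest critical setting, r = q = 2», p.263): `𝒯g(u) = {(g ⋆ g)(u)/(g ⋆ g)(e₀)}²`.
[cite: MullerSchiemann1987, (1.1) p.262, (2.4) p.263] -/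
theorem migdal_two (g : G → ℝ) (u : G) : migdal 2 g u = (haarConv g g u / haarConv g g 1) ^ 2 := rfl

/-- The class `𝒢 := {g(u) continuous class function on G, g(u) ≥ 0, g(e₀) = 1}` of p.283 (with (2.1) `g(e₀) = 1`).
[cite: MullerSchiemann1987, p.283 L.27–28, (2.1)–(2.2) p.263] -/
structure InG (g : G → ℝ) : Prop where
  continuous : Continuous g
  central : IsCentral g
  nonneg : ∀ u, 0 ≤ g u
  apply_one : g 1 = 1

/-! ### §2. Continuity iterates -/

/-- A continuous function on a compact group is Haar-integrable. [folklore] -/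
private theorem integrable_of_continuous {f : G → ℝ} (hf : Continuous f) : Integrable f (haarProbability G) :=
  hf.integrable_of_hasCompactSupport (HasCompactSupport.of_compactSpace _)

/-- `g` continuous ⇒ every `g^{*n}` continuous. [cite: MullerSchiemann1987, p.283 L.27] -/
theorem continuous_convPow {g : G → ℝ} (hg : Continuous g) : ∀ n, Continuous (convPow g n)
  | 0 => hg
  | n + 1 => continuous_haarConv hg (integrable_of_continuous (continuous_convPow hg n))

/-- `g` continuous ⇒ `𝒯g` continuous («𝒯 is continuous … on 𝒢», the pointwise half). [cite: MullerSchiemann1987, p.283 L.26–28] -/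
theorem continuous_migdal {g : G → ℝ} (hg : Continuous g) (r : ℕ) : Continuous (migdal r g) :=
  ((continuous_convPow hg _).div_const _).pow _

/-! ### §3. (2.2) iterates: convolutions of class functions are class functions -/

/-- `k`, `f` central ⇒ `k ⋆ f` central (substitute `v ↦ wvw⁻¹`, a Haar-preserving map).
[cite: MullerSchiemann1987, (2.2) p.263] -/
theorem isCentral_haarConv {k f : G → ℝ} (hk : IsCentral k) (hf : IsCentral f) : IsCentral (haarConv k f) := by
  intro u v
  have h1 := haarConv_comp_mul_right k (fun y => f (v * y)) v⁻¹ u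
  have h2 := haarConv_comp_mul_left hk f v (u * v⁻¹)
  have h3 : (fun y => f (v * (y * v⁻¹))) = f := funext fun y => by rw [← mul_assoc]; exact hf y v
  simp only [h3] at h1
  rw [show v * u * v⁻¹ = v * (u * v⁻¹) from mul_assoc _ _ _, ← h2, ← h1]

/-- **(2.2) iterates**: `g` central ⇒ every `g^{*n}` central. [cite: MullerSchiemann1987, (2.2) p.263] -/
theorem isCentral_convPow {g : G → ℝ} (hg : IsCentral g) : ∀ n, IsCentral (convPow g n)
  | 0 => hg
  | n + 1 => isCentral_haarConv hg (isCentral_convPow hg n)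

omit [TopologicalSpace G] [IsTopologicalGroup G] [CompactSpace G] [MeasurableSpace G] [BorelSpace G] in
/-- `u ↦ (f(u)/c)^r` is central when `f` is. [folklore] -/
private theorem isCentral_pow_div {f : G → ℝ} (hf : IsCentral f) (c : ℝ) (r : ℕ) :
    IsCentral fun u => (f u / c) ^ r := fun u v => by simp only [hf u v]

/-- **(2.2) iterates**: `g` central ⇒ `𝒯g` central. [cite: MullerSchiemann1987, (2.2) p.263] -/
theorem isCentral_migdal {g : G → ℝ} (hg : IsCentral g) (r : ℕ) : IsCentral (migdal r g) :=
  isCentral_pow_div (isCentral_convPow hg _) _ _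

/-! ### §4. (2.3) iterates -/

/-- `k` central with `k(u⁻¹) = k(u)` and `f(u⁻¹) = f(u)` ⇒ `(k ⋆ f)(u⁻¹) = (k ⋆ f)(u)`:
`∫ k(v) f(v⁻¹u⁻¹) dv = ∫ k(v) f(uv) dv = ∫ k(u⁻¹v) f(v) dv = ∫ k(uv⁻¹) f(v) dv` (left invariance `v ↦ uv`, then
`k(u⁻¹v) = k(v⁻¹u) = k(uv⁻¹)`). [cite: MullerSchiemann1987, (2.3) p.263] -/
theorem isSymm_haarConv {k f : G → ℝ} (hk : IsCentral k) (hks : IsSymm k) (hf : IsSymm f) :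
    IsSymm (haarConv k f) := by
  intro x
  rw [haarConv_apply, haarConv_eq_integral_mul_inv]
  have h1 : (fun h => k h * f (h⁻¹ * x⁻¹)) = fun h => (fun h' => k (x⁻¹ * h') * f h') (x * h) := by
    funext h
    simp only [inv_mul_cancel_left]
    rw [← mul_inv_rev, hf]
  rw [h1, integral_mul_left_eq_self (μ := haarProbability G) (fun h' => k (x⁻¹ * h') * f h') x]
  refine integral_congr_ae (Eventually.of_forall fun h => ?_)
  have h2 : k (x⁻¹ * h) = k (x * h⁻¹) := by
    rw [← hks (x⁻¹ * h), mul_inv_rev, inv_inv, central_apply_mul_inv hk]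
  simp only [h2]

/-- **(2.3) iterates**: `g` central with `g(u⁻¹) = g(u)` ⇒ the same for every `g^{*n}`.
[cite: MullerSchiemann1987, (2.3) p.263] -/
theorem isSymm_convPow {g : G → ℝ} (hg : IsCentral g) (hs : IsSymm g) : ∀ n, IsSymm (convPow g n)
  | 0 => hs
  | n + 1 => isSymm_haarConv hg hs (isSymm_convPow hg hs n)

/-- **(2.3) iterates**: `g` central with `g(u⁻¹) = g(u)` ⇒ `𝒯g(u⁻¹) = 𝒯g(u)`. [cite: MullerSchiemann1987, (2.3) p.263] -/
theorem isSymm_migdal {g : G → ℝ} (hg : IsCentral g) (hs : IsSymm g) (r : ℕ) : IsSymm (migdal r g) :=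
  fun u => by simp only [migdal_apply, isSymm_convPow hg hs _ u]

/-! ### §5. (2.1) iterates; positivity; `𝒯(𝒢) ⊆ 𝒢` -/

/-- **(2.1) iterates**: `𝒯g(e₀) = {g^{*r}(e₀)/g^{*r}(e₀)}^r = 1` as soon as `g^{*r}(e₀) ≠ 0`.
[cite: MullerSchiemann1987, (2.1) p.263, (1.1) p.262] -/
theorem migdal_apply_one {g : G → ℝ} {r : ℕ} (h : convPow g (r - 1) 1 ≠ 0) : migdal r g 1 = 1 := by
  rw [migdal_apply, div_self h, one_pow]

/-- `k, f ≥ 0` ⇒ `k ⋆ f ≥ 0`. [cite: MullerSchiemann1987, p.283 L.27–28] -/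
theorem haarConv_nonneg {k f : G → ℝ} (hk : ∀ u, 0 ≤ k u) (hf : ∀ u, 0 ≤ f u) (u : G) :
    0 ≤ haarConv k f u := by
  rw [haarConv_apply]
  exact integral_nonneg fun h => mul_nonneg (hk h) (hf _)

/-- `g ≥ 0` ⇒ every `g^{*n} ≥ 0`. [cite: MullerSchiemann1987, p.283 L.27–28] -/
theorem convPow_nonneg {g : G → ℝ} (hg : ∀ u, 0 ≤ g u) : ∀ n u, 0 ≤ convPow g n u
  | 0 => hg
  | n + 1 => haarConv_nonneg hg (convPow_nonneg hg n)

/-- A continuous integrand `≥ 0` which is `> 0` at one point has positive Haar integral (Haar measure charges open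
sets). [cite: MullerSchiemann1987, p.283 L.27–28] -/
private theorem integral_pos_of_continuous {F : G → ℝ} (hF : Continuous F) (h0 : ∀ v, 0 ≤ F v) {v₀ : G}
    (hv₀ : 0 < F v₀) : 0 < ∫ v, F v ∂(haarProbability G) :=
  hF.integral_pos_of_hasCompactSupport_nonneg_nonzero (HasCompactSupport.of_compactSpace _) h0 hv₀.ne'

/-- `k, f` continuous and `≥ 0` with `k(e₀) > 0`, `f(e₀) > 0` ⇒ `(k ⋆ f)(e₀) > 0` (the integrand `k(v)f(v⁻¹)` is
continuous, `≥ 0`, and positive at `v = e₀`). [cite: MullerSchiemann1987, p.283 L.27–28] -/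
theorem haarConv_apply_one_pos {k f : G → ℝ} (hk : Continuous k) (hf : Continuous f) (hk0 : ∀ u, 0 ≤ k u)
    (hf0 : ∀ u, 0 ≤ f u) (hk1 : 0 < k 1) (hf1 : 0 < f 1) : 0 < haarConv k f 1 := by
  rw [haarConv_apply]
  refine integral_pos_of_continuous (hk.mul (hf.comp (continuous_inv.mul continuous_const)))
    (fun v => mul_nonneg (hk0 v) (hf0 _)) (v₀ := 1) ?_
  simpa using mul_pos hk1 hf1

/-- `k, f` continuous and everywhere `> 0` ⇒ `k ⋆ f > 0` everywhere. [cite: MullerSchiemann1987, p.263 L.32–33] -/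
theorem haarConv_pos {k f : G → ℝ} (hk : Continuous k) (hf : Continuous f) (hk0 : ∀ u, 0 < k u)
    (hf0 : ∀ u, 0 < f u) (u : G) : 0 < haarConv k f u := by
  rw [haarConv_apply]
  exact integral_pos_of_continuous (hk.mul (hf.comp (continuous_inv.mul continuous_const)))
    (fun v => (mul_pos (hk0 v) (hf0 _)).le) (v₀ := 1) (mul_pos (hk0 1) (hf0 _))

/-- «real valued, positive» iterates: `g` continuous and `> 0` ⇒ every `g^{*n} > 0`. [cite: MullerSchiemann1987, p.263 L.32–33] -/
theorem convPow_pos {g : G → ℝ} (hg : Continuous g) (hg0 : ∀ u, 0 < g u) : ∀ n u, 0 < convPow g n u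
  | 0 => hg0
  | n + 1 => haarConv_pos hg (continuous_convPow hg n) hg0 (convPow_pos hg hg0 n)

/-- «real valued, positive» iterates: `g` continuous and `> 0` ⇒ `𝒯g > 0`. [cite: MullerSchiemann1987, p.263 L.32–33] -/
theorem migdal_pos {g : G → ℝ} (hg : Continuous g) (hg0 : ∀ u, 0 < g u) (r : ℕ) (u : G) : 0 < migdal r g u := by
  rw [migdal_apply]
  exact pow_pos (div_pos (convPow_pos hg hg0 _ u) (convPow_pos hg hg0 _ 1)) r

/-- **The denominator of (1.1) is positive on `𝒢`**: `g ∈ 𝒢` ⇒ `g^{*n}(e₀) > 0` for every `n` (induction: `g^{*n}`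
is continuous, `≥ 0`, and `> 0` at `e₀`, starting from `g(e₀) = 1`). [cite: MullerSchiemann1987, (1.1) p.262, p.283 L.27–28] -/
theorem convPow_apply_one_pos {g : G → ℝ} (hg : InG g) : ∀ n, 0 < convPow g n 1
  | 0 => by rw [convPow_zero, hg.apply_one]; exact one_pos
  | n + 1 => haarConv_apply_one_pos hg.continuous (continuous_convPow hg.continuous n) hg.nonneg
      (convPow_nonneg hg.nonneg n) (by rw [hg.apply_one]; exact one_pos) (convPow_apply_one_pos hg n)

/-- **(2.1) iterates on `𝒢`**: `g ∈ 𝒢` ⇒ `𝒯g(e₀) = 1`. [cite: MullerSchiemann1987, (2.1) p.263] -/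
theorem migdal_one_of_inG {g : G → ℝ} (hg : InG g) (r : ℕ) : migdal r g 1 = 1 :=
  migdal_apply_one (convPow_apply_one_pos hg _).ne'

/-- **`𝒯` maps `𝒢` into `𝒢`**: for `g ∈ 𝒢`, `𝒯g` is continuous, a class function, `≥ 0`, and `𝒯g(e₀) = 1` — the
properties (2.1), (2.2) «valid for n ∈ ℕ₀» together with the membership needed for the iteration on p.283.
[cite: MullerSchiemann1987, (2.1)–(2.2) p.263, p.283 L.25–28] -/
theorem inG_migdal {g : G → ℝ} (hg : InG g) (r : ℕ) : InG (migdal r g) where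
  continuous := continuous_migdal hg.continuous r
  central := isCentral_migdal hg.central r
  nonneg u := by
    rw [migdal_apply]
    exact pow_nonneg (div_nonneg (convPow_nonneg hg.nonneg _ u) (convPow_apply_one_pos hg _).le) r
  apply_one := migdal_one_of_inG hg r

/-- Hence all iterates `𝒯ⁿg` stay in `𝒢` («valid for n ∈ ℕ₀»). [cite: MullerSchiemann1987, (2.1)–(2.2) p.263] -/
theorem inG_iterate_migdal {g : G → ℝ} (hg : InG g) (r : ℕ) : ∀ n, InG ((migdal r)^[n] g)
  | 0 => hg
  | n + 1 => by rw [Function.iterate_succ_apply']; exact inG_migdal (inG_iterate_migdal hg r n) r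

/-! ### §6. (5.1)–(5.3) at zero angle; (2.4)/(3.1) on the real slice -/

/-- **(5.3)**: under (2.3), `(g ⋆ g)(e₀) = ∫ [g(v)]² dv = M`. [cite: MullerSchiemann1987, (5.3) p.275] -/
theorem haarConv_self_apply_one {g : G → ℝ} (hs : IsSymm g) :
    haarConv g g 1 = ∫ v, g v ^ 2 ∂(haarProbability G) := by
  rw [Literature.MathematicalPhysics.QuantumLattice.haarConv_apply_one_of_symm hs]
  simp only [sq]

/-- **(5.1)–(5.2) at `y = 0`**: under (2.3), `𝒯g(u) = {J(u)/M}²` with `J(u) = ∫ g(uv⁻¹) g(v) dv` and `M = ∫ [g(v)]² dv`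
— so the normalisation of (2.4)/(3.1) is `𝒩 = M²`. [cite: MullerSchiemann1987, (5.1)–(5.3) p.275, (2.4) p.263] -/
theorem migdal_two_eq_J_div_M_sq {g : G → ℝ} (hs : IsSymm g) (u : G) :
    migdal 2 g u = ((∫ v, g (u * v⁻¹) * g v ∂(haarProbability G)) / ∫ v, g v ^ 2 ∂(haarProbability G)) ^ 2 := by
  rw [migdal_two, haarConv_self_apply_one hs, haarConv_eq_integral_mul_inv]

/-- **The substitution behind (2.4)/(3.1)**: for a central `g` and any `a ∈ G`,
`(g ⋆ f)(a²u) = ∫ g(auv⁻¹) f(av) dv` (left invariance `v ↦ av`, then `g(a·(auv⁻¹)·a⁻¹) = g(auv⁻¹)` by (2.2)).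
[cite: MullerSchiemann1987, (2.4) p.263, (3.1) p.266] -/
theorem haarConv_sq_mul {g : G → ℝ} (hg : IsCentral g) (f : G → ℝ) (a u : G) :
    haarConv g f (a * a * u) = ∫ v, g (a * u * v⁻¹) * f (a * v) ∂(haarProbability G) := by
  rw [haarConv_eq_integral_mul_inv,
    ← integral_mul_left_eq_self (μ := haarProbability G) (fun h => g (a * a * u * h⁻¹) * f h) a]
  refine integral_congr_ae (Eventually.of_forall fun v => ?_)
  have h1 : a * a * u * (a * v)⁻¹ = a * (a * u * v⁻¹) * a⁻¹ := by simp only [mul_inv_rev, mul_assoc]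
  simp only [h1, hg (a * u * v⁻¹) a]

/-- **(2.4) = (3.1) on the real slice is (1.1)**: for a central `g` with (2.3) and any `a ∈ G`,
`𝒯g(a²u) = {∫ g(auv⁻¹) g(av) dv / M}²`, `M = ∫ [g(v)]² dv`. [cite: MullerSchiemann1987, (2.4) p.263, (3.1) p.266, (5.1)–(5.3) p.275] -/
theorem migdal_two_sq_mul {g : G → ℝ} (hg : IsCentral g) (hs : IsSymm g) (a u : G) :
    migdal 2 g (a * a * u) =
      ((∫ v, g (a * u * v⁻¹) * g (a * v) ∂(haarProbability G)) / ∫ v, g v ^ 2 ∂(haarProbability G)) ^ 2 := by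
  rw [migdal_two, haarConv_sq_mul hg, haarConv_self_apply_one hs]

/-! ### §8 (v1.1). Property (i) of p.283: `𝒯` is continuous on `𝒢` in the supremum norm

«(i) 𝒯 is continuous (with respect to the supremum norm) on 𝒢». Formalized as: if `gᵢ → g` uniformly on `G`
along any filter, all `gᵢ` and `g` in `𝒢`, then `𝒯gᵢ → 𝒯g` uniformly (`tendstoUniformly_migdal`). Steps:
`|k ⋆ f − k′ ⋆ f′| ≤ sup|k − k′|·sup|f| + sup|k′|·sup|f − f′|` (`abs_haarConv_sub_haarConv_le`), induction over the
convolution powers, then the quotient by `g^{*r}(e₀) > 0` and the `r`-th power on a bounded range. -/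

/-- `|(k ⋆ f)(u) − (k′ ⋆ f′)(u)| ≤ δ_k B_f + B_{k′} δ_f` when `|k − k′| ≤ δ_k`, `|f| ≤ B_f`, `|k′| ≤ B_{k′}`,
`|f − f′| ≤ δ_f` pointwise (all four continuous; the Haar measure is a probability).
[cite: MullerSchiemann1987, p.283 L.25–28] -/
theorem abs_haarConv_sub_haarConv_le {k k' f f' : G → ℝ} (hk : Continuous k) (hk' : Continuous k')
    (hf : Continuous f) (hf' : Continuous f') {δk Bf Bk' δf : ℝ} (h1 : ∀ u, |k u - k' u| ≤ δk)
    (h2 : ∀ u, |f u| ≤ Bf) (h3 : ∀ u, |k' u| ≤ Bk') (h4 : ∀ u, |f u - f' u| ≤ δf) (u : G) :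
    |haarConv k f u - haarConv k' f' u| ≤ δk * Bf + Bk' * δf := by
  have hi : ∀ {a b : G → ℝ}, Continuous a → Continuous b →
      Integrable (fun h => a h * b (h⁻¹ * u)) (haarProbability G) := fun ha hb =>
    integrable_of_continuous (ha.mul (hb.comp (continuous_inv.mul continuous_const)))
  rw [haarConv_apply, haarConv_apply, ← integral_sub (hi hk hf) (hi hk' hf')]
  have hpt : ∀ h, |k h * f (h⁻¹ * u) - k' h * f' (h⁻¹ * u)| ≤ δk * Bf + Bk' * δf := by
    intro h
    have e : k h * f (h⁻¹ * u) - k' h * f' (h⁻¹ * u) =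
        (k h - k' h) * f (h⁻¹ * u) + k' h * (f (h⁻¹ * u) - f' (h⁻¹ * u)) := by ring
    rw [e]
    refine (abs_add_le _ _).trans (add_le_add ?_ ?_)
    · rw [abs_mul]; exact mul_le_mul (h1 h) (h2 _) (abs_nonneg _) ((abs_nonneg _).trans (h1 h))
    · rw [abs_mul]; exact mul_le_mul (h3 h) (h4 _) (abs_nonneg _) ((abs_nonneg _).trans (h3 h))
  have := norm_integral_le_of_norm_le_const (μ := haarProbability G)
    (f := fun h => k h * f (h⁻¹ * u) - k' h * f' (h⁻¹ * u)) (C := δk * Bf + Bk' * δf)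
    (ae_of_all _ fun h => by simpa only [Real.norm_eq_abs] using hpt h)
  simpa only [Real.norm_eq_abs, probReal_univ, mul_one] using this

/-- A uniform bound for `g^{*n}`: `|g| ≤ B` (`B ≥ 0`) ⇒ `|g^{*(n+1)}| ≤ B^{n+1}`. [cite: MullerSchiemann1987, p.283 L.25–28] -/
theorem abs_convPow_le {g : G → ℝ} (hg : Continuous g) {B : ℝ} (hB : ∀ u, |g u| ≤ B) :
    ∀ n u, |convPow g n u| ≤ B ^ (n + 1)
  | 0, u => by simpa using hB u
  | n + 1, u => by
    rw [convPow_succ, pow_succ, mul_comm]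
    refine (Literature.MathematicalPhysics.QuantumLattice.abs_haarConv_le hB
      (integrable_of_continuous (continuous_convPow hg n)) u).trans ?_
    refine mul_le_mul_of_nonneg_left ?_ ((abs_nonneg _).trans (hB 1))
    calc ∫ h, |convPow g n h| ∂haarProbability G ≤ ∫ _h, B ^ (n + 1) ∂haarProbability G :=
          integral_mono (integrable_of_continuous (continuous_convPow hg n)).abs (integrable_const _)
            fun h => abs_convPow_le hg hB n h
      _ = B ^ (n + 1) := by simp

/-- **Uniform continuity of `g ↦ g^{*n}` in the sup norm along 𝒢-valued families**: if `gᵢ → g` uniformly (all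
continuous) then `gᵢ^{*n} → g^{*n}` uniformly, for every `n`. [cite: MullerSchiemann1987, p.283 L.25–28] -/
theorem convPow_sub_uniform {ι : Type*} {l : Filter ι} {gs : ι → G → ℝ} {g : G → ℝ}
    (hgs : ∀ i, Continuous (gs i)) (hg : Continuous g)
    (h : ∀ ε > 0, ∀ᶠ i in l, ∀ u, |gs i u - g u| ≤ ε) :
    ∀ n, ∀ ε > 0, ∀ᶠ i in l, ∀ u, |convPow (gs i) n u - convPow g n u| ≤ ε
  | 0 => h
  | n + 1 => by
    intro ε hε
    obtain ⟨B, hB0, hB⟩ := Literature.MathematicalPhysics.QuantumLattice.exists_forall_abs_le_of_continuous hg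
    obtain ⟨Bn, hBn0, hBn⟩ :=
      Literature.MathematicalPhysics.QuantumLattice.exists_forall_abs_le_of_continuous (continuous_convPow hg n)
    set ε₁ := ε / (2 * (Bn + 1)) with hε₁
    set ε₂ := min 1 (ε / (2 * (B + 1))) with hε₂
    have hε₁0 : 0 < ε₁ := by positivity
    have hε₂0 : 0 < ε₂ := lt_min one_pos (by positivity)
    filter_upwards [h ε₁ hε₁0, convPow_sub_uniform hgs hg h n ε₂ hε₂0] with i hi1 hi2
    intro u
    rw [convPow_succ, convPow_succ]
    have hBf : ∀ v, |convPow (gs i) n v| ≤ Bn + 1 := fun v => by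
      have := abs_sub_abs_le_abs_sub (convPow (gs i) n v) (convPow g n v)
      linarith [hi2 v, hBn v, min_le_left 1 (ε / (2 * (B + 1)))]
    refine (abs_haarConv_sub_haarConv_le (hgs i) hg (continuous_convPow (hgs i) n) (continuous_convPow hg n)
      hi1 hBf hB hi2 u).trans ?_
    have hA : ε₁ * (Bn + 1) = ε / 2 := by rw [hε₁]; field_simp
    have hB' : B * ε₂ ≤ ε / 2 := by
      calc B * ε₂ ≤ B * (ε / (2 * (B + 1))) := mul_le_mul_of_nonneg_left (min_le_right _ _) hB0
        _ = (B / (B + 1)) * (ε / 2) := by field_simp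
        _ ≤ 1 * (ε / 2) := by
            refine mul_le_mul_of_nonneg_right ?_ (by positivity)
            rw [div_le_one (by positivity)]; linarith
        _ = ε / 2 := one_mul _
    linarith

/-- **Property (i) of p.283 — `𝒯` is continuous on `𝒢` with respect to the supremum norm**: if `gᵢ → g` uniformly on
`G` (along any filter), all `gᵢ` and `g` in `𝒢`, then `𝒯gᵢ → 𝒯g` uniformly on `G`.
[cite: MullerSchiemann1987, p.283 L.25–28] -/
theorem migdal_sub_uniform {ι : Type*} {l : Filter ι} {gs : ι → G → ℝ} {g : G → ℝ}
    (hgs : ∀ i, InG (gs i)) (hg : InG g) (h : ∀ ε > 0, ∀ᶠ i in l, ∀ u, |gs i u - g u| ≤ ε) (r : ℕ) :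
    ∀ ε > 0, ∀ᶠ i in l, ∀ u, |migdal r (gs i) u - migdal r g u| ≤ ε := by
  intro ε hε
  -- data: a = g^{*r}, c = a(e₀) > 0, |a| ≤ A
  set n := r - 1
  have hc : 0 < convPow g n 1 := convPow_apply_one_pos hg n
  set c := convPow g n 1 with hc_def
  obtain ⟨A, hA0, hA⟩ :=
    Literature.MathematicalPhysics.QuantumLattice.exists_forall_abs_le_of_continuous (continuous_convPow hg.continuous n)
  -- the quotients live in `[-(Q+1), Q+1]`, `Q = A / c`; Lipschitz constant of `x ↦ x^r` there
  set Q := A / c with hQ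
  have hQ0 : 0 ≤ Q := div_nonneg hA0 hc.le
  set Lr : ℝ := r * (Q + 1) ^ (r - 1) + 1 with hLr
  have hLr0 : 0 < Lr := by positivity
  -- tolerance for the uniform closeness of the convolution powers
  set δ := min (c / 2) (min (c ^ 2 / (2 * (c + A))) (ε * c ^ 2 / (2 * (c + A) * Lr))) with hδ
  have hδ0 : 0 < δ := lt_min (by positivity) (lt_min (by positivity) (by positivity))
  filter_upwards [convPow_sub_uniform (fun i => (hgs i).continuous) hg.continuous h n δ hδ0] with i hi
  intro u
  have hci : c / 2 ≤ convPow (gs i) n 1 := by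
    have := abs_le.mp (hi 1); have := min_le_left (c / 2) (min (c ^ 2 / (2 * (c + A))) (ε * c ^ 2 / (2 * (c + A) * Lr)))
    linarith
  have hci0 : 0 < convPow (gs i) n 1 := lt_of_lt_of_le (by positivity) hci
  -- quotient estimate: |aᵢ/cᵢ − a/c| ≤ 2δ(c + A)/c²
  have hquot : |convPow (gs i) n u / convPow (gs i) n 1 - convPow g n u / c| ≤ 2 * δ * (c + A) / c ^ 2 := by
    rw [div_sub_div _ _ hci0.ne' hc.ne', abs_div, abs_mul, abs_of_pos hci0, abs_of_pos hc]
    have hnum : |convPow (gs i) n u * c - convPow (gs i) n 1 * convPow g n u| ≤ δ * c + A * δ := by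
      have e : convPow (gs i) n u * c - convPow (gs i) n 1 * convPow g n u =
          (convPow (gs i) n u - convPow g n u) * c + convPow g n u * (c - convPow (gs i) n 1) := by ring
      rw [e]
      refine (abs_add_le _ _).trans (add_le_add ?_ ?_)
      · rw [abs_mul, abs_of_pos hc]; exact mul_le_mul_of_nonneg_right (hi u) hc.le
      · rw [abs_mul]
        refine mul_le_mul (hA u) ?_ (abs_nonneg _) hA0
        rw [abs_sub_comm]; exact hi 1
    calc |convPow (gs i) n u * c - convPow (gs i) n 1 * convPow g n u| / (convPow (gs i) n 1 * c)
        ≤ (δ * c + A * δ) / (c / 2 * c) := by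
          refine div_le_div₀ (by positivity) hnum (by positivity) (mul_le_mul_of_nonneg_right hci hc.le)
      _ = 2 * δ * (c + A) / c ^ 2 := by field_simp
  have hquot1 : 2 * δ * (c + A) / c ^ 2 ≤ 1 := by
    have hδ2 : δ ≤ c ^ 2 / (2 * (c + A)) := (min_le_right _ _).trans (min_le_left _ _)
    rw [div_le_one (by positivity)]
    calc 2 * δ * (c + A) ≤ 2 * (c ^ 2 / (2 * (c + A))) * (c + A) := by gcongr
      _ = c ^ 2 := by field_simp
  -- both quotients bounded by Q + 1
  have hx : |convPow g n u / c| ≤ Q + 1 := by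
    rw [abs_div, abs_of_pos hc, hQ]; exact (div_le_div_of_nonneg_right (hA u) hc.le).trans (le_add_of_nonneg_right zero_le_one)
  have hy : |convPow (gs i) n u / convPow (gs i) n 1| ≤ Q + 1 := by
    have := abs_sub_abs_le_abs_sub (convPow (gs i) n u / convPow (gs i) n 1) (convPow g n u / c)
    have hx' : |convPow g n u / c| ≤ Q := by
      rw [abs_div, abs_of_pos hc, hQ]; exact div_le_div_of_nonneg_right (hA u) hc.le
    linarith
  -- the r-th powers
  rw [migdal_apply, migdal_apply]
  refine (abs_pow_sub_pow_le _ _ _).trans ?_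
  have hmax : max |convPow (gs i) n u / convPow (gs i) n 1| |convPow g n u / c| ≤ Q + 1 := max_le hy hx
  calc |convPow (gs i) n u / convPow (gs i) n 1 - convPow g n u / c| * r *
        max |convPow (gs i) n u / convPow (gs i) n 1| |convPow g n u / c| ^ (r - 1)
      ≤ (2 * δ * (c + A) / c ^ 2) * r * (Q + 1) ^ (r - 1) := by gcongr
    _ ≤ (2 * δ * (c + A) / c ^ 2) * Lr := by
        rw [mul_assoc]
        refine mul_le_mul_of_nonneg_left (by rw [hLr]; linarith) (by positivity)
    _ ≤ ε := by
        have hδ3 : δ ≤ ε * c ^ 2 / (2 * (c + A) * Lr) := (min_le_right _ _).trans (min_le_right _ _)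
        calc 2 * δ * (c + A) / c ^ 2 * Lr ≤ 2 * (ε * c ^ 2 / (2 * (c + A) * Lr)) * (c + A) / c ^ 2 * Lr := by
              gcongr
          _ = ε := by field_simp

/-- Property (i) in Mathlib's vocabulary: `TendstoUniformly gs g l` with all `gᵢ, g ∈ 𝒢` implies
`TendstoUniformly (𝒯 ∘ gs) (𝒯g) l`. [cite: MullerSchiemann1987, p.283 L.25–28] -/
theorem tendstoUniformly_migdal {ι : Type*} {l : Filter ι} {gs : ι → G → ℝ} {g : G → ℝ}
    (hgs : ∀ i, InG (gs i)) (hg : InG g) (h : TendstoUniformly gs g l) (r : ℕ) :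
    TendstoUniformly (fun i => migdal r (gs i)) (migdal r g) l := by
  rw [Metric.tendstoUniformly_iff] at h ⊢
  intro ε hε
  have h' : ∀ ε > 0, ∀ᶠ i in l, ∀ u, |gs i u - g u| ≤ ε := fun ε hε =>
    (h ε hε).mono fun i hi u => by rw [abs_sub_comm, ← Real.dist_eq]; exact (hi u).le
  filter_upwards [migdal_sub_uniform hgs hg h' r (ε / 2) (half_pos hε)] with i hi
  intro u
  rw [Real.dist_eq, abs_sub_comm]
  exact (hi u).trans_lt (half_lt_self hε)

/-! ### §9 (v1.1). (4.3)–(4.5) on the real slice: `h′ = {K(1 + L)/(1 + L(0))}²`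

p.269: *«we write, recalling (3.1) and the symmetry (2.9), h′(z) = {K(z)(1 + L(z))/(1 + L(0))}², (4.3) with
K(z) = ∫dv χ(v) g̃(v, z/2) g̃(v, −z/2) / ∫dv χ(v) g(v)² (4.4) and L(z) = ∫dv [1 − χ(v)] g̃(v, z/2) g̃(v, −z/2) /
∫dv χ(v) g̃(v, z/2) g̃(v, −z/2). (4.5)»* — here for a real angle, i.e. with `g̃(v, ±x/2) = g(a^{±1}v)`, `a = e^{−(i/2)xσ₃}`
(any `a ∈ G`), `h′(x) = g̃′(e₀, x) = 𝒯g(a²)`, and an arbitrary integrable weight `χ` (the paper's `χ` is the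
characteristic function (4.2) of a neighbourhood of `e₀`). -/

/-- The numerators of (4.4)–(4.5): `N_χ(a) = ∫ χ(v) g(a⁻¹v) g(av) dv` (= `∫dv χ(v) g̃(v, −x/2) g̃(v, x/2)` for
`a = e^{−(i/2)xσ₃}`). [cite: MullerSchiemann1987, (4.4)–(4.5) p.269] -/
def numK (χ g : G → ℝ) (a : G) : ℝ := ∫ v, χ v * (g (a⁻¹ * v) * g (a * v)) ∂(haarProbability G)

/-- **(4.4)**: `K = N_χ(a) / ∫ χ(v) g(v)² dv`. [cite: MullerSchiemann1987, (4.4) p.269] -/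
def Kfun (χ g : G → ℝ) (a : G) : ℝ := numK χ g a / ∫ v, χ v * g v ^ 2 ∂(haarProbability G)

/-- **(4.5)**: `L = N_{1−χ}(a) / N_χ(a)`. [cite: MullerSchiemann1987, (4.5) p.269] -/
def Lfun (χ g : G → ℝ) (a : G) : ℝ := numK (fun v => 1 - χ v) g a / numK χ g a

/-- At zero angle `N_χ(e₀) = ∫ χ g²` (the denominator of (4.4), «obviously positive»). [cite: MullerSchiemann1987, (4.4) p.269] -/
theorem numK_one (χ g : G → ℝ) : numK χ g 1 = ∫ v, χ v * g v ^ 2 ∂(haarProbability G) := by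
  simp only [numK, inv_one, one_mul, sq]

/-- **(3.1) at `u = e₀` with the symmetry (2.9)**: for a central `g` with (2.3),
`(g ⋆ g)(a²) = ∫ g(a⁻¹v) g(av) dv` (`= ∫dv g̃(v, −x/2) g̃(v, x/2)`; from `haarConv_sq_mul` at `u = e₀` and
`g(av⁻¹) = g(va⁻¹) = g(a⁻¹v)`). [cite: MullerSchiemann1987, (3.1) p.266, (2.9) p.264, (4.3) p.269] -/
theorem haarConv_self_sq {g : G → ℝ} (hg : IsCentral g) (hs : IsSymm g) (a : G) :
    haarConv g g (a * a) = ∫ v, g (a⁻¹ * v) * g (a * v) ∂(haarProbability G) := by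
  rw [← mul_one (a * a), haarConv_sq_mul hg g a 1]
  refine integral_congr_ae (Eventually.of_forall fun v => ?_)
  have h1 : g (a * 1 * v⁻¹) = g (a⁻¹ * v) := by
    rw [mul_one, ← hs, mul_inv_rev, inv_inv, ← hg (v * a⁻¹) a⁻¹, inv_inv, ← mul_assoc, inv_mul_cancel_right]
  simp only [h1]

/-- `N_χ + N_{1−χ} = (g ⋆ g)(a²)` (splitting the integral; `χ` integrable, `g` continuous).
[cite: MullerSchiemann1987, (4.3)–(4.5) p.269] -/
theorem numK_add_numK_compl {χ g : G → ℝ} (hχ : Integrable χ (haarProbability G)) (hg : InG g) (hs : IsSymm g)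
    (a : G) : numK χ g a + numK (fun v => 1 - χ v) g a = haarConv g g (a * a) := by
  have hF : Continuous fun v => g (a⁻¹ * v) * g (a * v) :=
    (hg.continuous.comp (continuous_const.mul continuous_id)).mul (hg.continuous.comp (continuous_const.mul continuous_id))
  obtain ⟨C, -, hC⟩ := Literature.MathematicalPhysics.QuantumLattice.exists_forall_abs_le_of_continuous hF
  have hi : ∀ {w : G → ℝ}, Integrable w (haarProbability G) →
      Integrable (fun v => w v * (g (a⁻¹ * v) * g (a * v))) (haarProbability G) := fun hw =>
    hw.mul_bdd (c := C) hF.aestronglyMeasurable (ae_of_all _ fun v => by simpa [Real.norm_eq_abs] using hC v)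
  have hχ' : Integrable (fun v => 1 - χ v) (haarProbability G) := (integrable_const 1).sub hχ
  rw [numK, numK, ← integral_add (hi hχ) (hi hχ'), haarConv_self_sq hg.central hs]
  refine integral_congr_ae (Eventually.of_forall fun v => ?_)
  ring

/-- **(4.3) on the real slice**: for `g ∈ 𝒢` with (2.3), any `a ∈ G` and any integrable weight `χ` with
`∫ χ g² ≠ 0`, `N_χ(a) ≠ 0` (the paper: «obviously positive» resp. «non-zero, too»),
`h′ := 𝒯g(a²) = {K(a)(1 + L(a))/(1 + L(e₀))}²` with `K, L` of (4.4), (4.5).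
[cite: MullerSchiemann1987, (4.3)–(4.5) p.269] -/
theorem eq43_real {χ g : G → ℝ} (hχ : Integrable χ (haarProbability G)) (hg : InG g) (hs : IsSymm g) (a : G)
    (h0 : ∫ v, χ v * g v ^ 2 ∂(haarProbability G) ≠ 0) (ha : numK χ g a ≠ 0) :
    migdal 2 g (a * a) = (Kfun χ g a * ((1 + Lfun χ g a) / (1 + Lfun χ g 1))) ^ 2 := by
  have h1 : numK χ g 1 ≠ 0 := by rwa [numK_one]
  have hsum := numK_add_numK_compl hχ hg hs a
  have hsum1 := numK_add_numK_compl hχ hg hs 1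
  rw [mul_one] at hsum1
  rw [migdal_two, ← hsum, ← hsum1, Kfun, Lfun, Lfun, ← numK_one]
  congr 1
  field_simp

/-! ### §10 (v1.1). `r = 4`: the recursion (3.8) on the real slice

p.267: *«In the case of a lattice gauge model in 4 dimensions with smallest block length (l = 2) we have to deal
instead of (3.1) with the recursion relation – see (2.1), (2.10 M) of (I) with q = r = 4 –
g̃′(u, z) = (1/𝒩){∫ dv₁dv₂dv₃ g̃(uv₁⁻¹, z/4) g̃(v₁v₂⁻¹, z/4) g̃(v₂v₃⁻¹, z/4) g̃(v₃, z/4)}⁴. (3.8)»* — (1.1) with `r = 4`;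
here at a real angle `x`, `g̃(w, x/4) = g(aw)` with `a⁴ = e^{−ixσ₃}`, the triple integral written as an iterated one. -/

/-- (1.1) for `r = 4`: `𝒯g(u) = {g^{*4}(u)/g^{*4}(e₀)}⁴`. [cite: MullerSchiemann1987, (1.1) p.262, (3.8) p.267] -/
theorem migdal_four (g : G → ℝ) (u : G) : migdal 4 g u = (convPow g 3 u / convPow g 3 1) ^ 4 := rfl

/-- `g^{*4}` as the iterated integral of (3.8) at zero angle:
`g^{*4}(u) = ∫dv₁ g(uv₁⁻¹) ∫dv₂ g(v₁v₂⁻¹) ∫dv₃ g(v₂v₃⁻¹) g(v₃)`. [cite: MullerSchiemann1987, (3.8) p.267] -/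
theorem convPow_three_apply (g : G → ℝ) (u : G) :
    convPow g 3 u = ∫ v₁, g (u * v₁⁻¹) * ∫ v₂, g (v₁ * v₂⁻¹) * ∫ v₃, g (v₂ * v₃⁻¹) * g v₃ ∂(haarProbability G)
      ∂(haarProbability G) ∂(haarProbability G) := by
  simp only [convPow, haarConv_eq_integral_mul_inv]

/-- **The substitution behind (3.8)**: for a central `k`, `(k ⋆ f)(a^{m+1}u) = ∫ k(auw⁻¹) f(a^m w) dw` (left invariance
`v ↦ a^m w`, then `k(a^m·(auw⁻¹)·a^{−m}) = k(auw⁻¹)`). [cite: MullerSchiemann1987, (3.8) p.267, (2.2) p.263] -/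
theorem haarConv_pow_succ_mul {k : G → ℝ} (hk : IsCentral k) (f : G → ℝ) (a u : G) (m : ℕ) :
    haarConv k f (a ^ (m + 1) * u) = ∫ w, k (a * u * w⁻¹) * f (a ^ m * w) ∂(haarProbability G) := by
  rw [haarConv_eq_integral_mul_inv,
    ← integral_mul_left_eq_self (μ := haarProbability G) (fun v => k (a ^ (m + 1) * u * v⁻¹) * f v) (a ^ m)]
  refine integral_congr_ae (Eventually.of_forall fun w => ?_)
  have h1 : a ^ (m + 1) * u * (a ^ m * w)⁻¹ = a ^ m * (a * u * w⁻¹) * (a ^ m)⁻¹ := by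
    simp only [pow_succ, mul_inv_rev, mul_assoc]
  simp only [h1, hk (a * u * w⁻¹) (a ^ m)]

/-- **(3.8) on the real slice is (1.1) with `r = 4`**: for a central `g` and any `a ∈ G`,
`g^{*4}(a⁴u) = ∫dw₁ g(auw₁⁻¹) ∫dw₂ g(aw₁w₂⁻¹) ∫dw₃ g(aw₂w₃⁻¹) g(aw₃)`; with `G = SU(2)`, `a = e^{−(i/4)xσ₃}` this is the
brace of (3.8) at the real angle `x` (`g̃(w, x/4) = g(aw)`), and `𝒯g(a⁴u)` is its fourth power over `g^{*4}(e₀)⁴`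
(`migdal_four`). [cite: MullerSchiemann1987, (3.8) p.267] -/
theorem eq38_real {g : G → ℝ} (hg : IsCentral g) (a u : G) :
    convPow g 3 (a ^ 4 * u) =
      ∫ w₁, g (a * u * w₁⁻¹) * ∫ w₂, g (a * w₁ * w₂⁻¹) * ∫ w₃, g (a * w₂ * w₃⁻¹) * g (a * w₃) ∂(haarProbability G)
        ∂(haarProbability G) ∂(haarProbability G) := by
  have e3 : convPow g 3 (a ^ 4 * u) = ∫ w₁, g (a * u * w₁⁻¹) * convPow g 2 (a ^ 3 * w₁) ∂(haarProbability G) :=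
    haarConv_pow_succ_mul hg _ a u 3
  have e2 : ∀ w₁, convPow g 2 (a ^ 3 * w₁) = ∫ w₂, g (a * w₁ * w₂⁻¹) * convPow g 1 (a ^ 2 * w₂) ∂(haarProbability G) :=
    fun w₁ => haarConv_pow_succ_mul hg _ a w₁ 2
  have e1 : ∀ w₂, convPow g 1 (a ^ 2 * w₂) = ∫ w₃, g (a * w₂ * w₃⁻¹) * g (a ^ 1 * w₃) ∂(haarProbability G) :=
    fun w₂ => haarConv_pow_succ_mul hg _ a w₂ 1
  simp only [e3, e2, e1, pow_one]

/-! ### §11 (v1.1). Theorem 3, the inductive step (p.283 L.31–37): unique limits from (i) and (ii)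

p.283: *«We fix the subsequence N_j such that (6.19) holds for n = 0, and prove (6.19) inductively for all n ∈ ℕ.
Assume (6.19), and thus (6.22), at scale n. The sequence (g̃^{(N_j,−n−1)}(z)) of the preceding scale, being a normal
family … due to Theorem 2, has convergent subsequences, with corresponding limits (6.22) of the Gibbs factors
g^{(N_j,−n−1)}(u). Those are mapped onto g^{(−n)}(u) due to (i); thus there is a unique limit
g^{(−n−1)}(u) = lim_{j→∞} g^{(N_j,−n−1)}(u) due to (ii), which shows (6.19), (6.22) for n + 1.»* Formalized
abstractly: the sequence `gs j = g^{(N_j,−n−1)} ∈ 𝒢`, its relative compactness with limits in a set `S₀ ⊆ 𝒢` on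
which `𝒯` is injective (property (ii) and «of positive type» enter as the HYPOTHESES `hinj`, `hnormal` — they are
Theorem 2 part 4) and (ii), not proved here), and `𝒯(gs j) → g^{(−n)}` uniformly; conclusion: the whole sequence
converges uniformly to the unique `g ∈ S₀` with `𝒯g = g^{(−n)}`. Property (i) enters through `tendstoUniformly_migdal`. -/

omit [Group G] [TopologicalSpace G] [IsTopologicalGroup G] [CompactSpace G] [MeasurableSpace G] [BorelSpace G] in
/-- A subsequence of a uniformly convergent sequence converges uniformly to the same limit. [folklore] -/
private theorem tendstoUniformly_subseq {F : ℕ → G → ℝ} {f : G → ℝ} (h : TendstoUniformly F f atTop)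
    {φ : ℕ → ℕ} (hφ : StrictMono φ) : TendstoUniformly (fun k => F (φ k)) f atTop :=
  fun u hu => hφ.tendsto_atTop.eventually (h u hu)

omit [Group G] [TopologicalSpace G] [IsTopologicalGroup G] [CompactSpace G] [MeasurableSpace G] [BorelSpace G] in
/-- Uniform limits are unique. [folklore] -/
private theorem tendstoUniformly_unique {F : ℕ → G → ℝ} {f f' : G → ℝ} (h : TendstoUniformly F f atTop)
    (h' : TendstoUniformly F f' atTop) : f = f' :=
  funext fun x => tendsto_nhds_unique (h.tendsto_at x) (h'.tendsto_at x)

/-- **Theorem 3, inductive step** (p.283 L.31–37), abstract form. Let `gs j ∈ 𝒢` (the Gibbs factors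
`g^{(N_j,−n−1)}` of the preceding scale), let every subsequence of `gs` have a sub-subsequence converging uniformly on
`G` to some element of a set `S₀ ⊆ 𝒢` («normal family», Theorem 2 part 4), with limits of positive type), let `𝒯` be
injective on `S₀` (property (ii)), and let `𝒯(gs j) → gₙ` uniformly (the induction hypothesis (6.22) at scale `n`).
Then there is a unique-by-(ii) `g ∈ S₀` with `𝒯g = gₙ`, and the WHOLE sequence `gs` converges to it uniformly
((6.19)/(6.22) at scale `n + 1`) — «those are mapped onto g^{(−n)} due to (i); thus there is a unique limit … due
to (ii)». [cite: MullerSchiemann1987, Thm 3 proof p.283 L.31–37] -/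
theorem thm3_inductive_step {gs : ℕ → G → ℝ} {S₀ : Set (G → ℝ)} {r : ℕ} {gn : G → ℝ}
    (hgs : ∀ j, InG (gs j)) (hS₀ : ∀ g ∈ S₀, InG g)
    (hnormal : ∀ φ : ℕ → ℕ, StrictMono φ →
      ∃ ψ : ℕ → ℕ, StrictMono ψ ∧ ∃ g ∈ S₀, TendstoUniformly (fun k => gs (φ (ψ k))) g atTop)
    (hinj : Set.InjOn (migdal r) S₀) (hlim : TendstoUniformly (fun j => migdal r (gs j)) gn atTop) :
    ∃ g ∈ S₀, migdal r g = gn ∧ TendstoUniformly gs g atTop := by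
  -- (i): every subsequential limit `g' ∈ S₀` is mapped onto `gₙ`
  have hA : ∀ {φ : ℕ → ℕ}, StrictMono φ → ∀ {g' : G → ℝ}, g' ∈ S₀ →
      TendstoUniformly (fun k => gs (φ k)) g' atTop → migdal r g' = gn := by
    intro φ hφ g' hg' hconv
    have h1 : TendstoUniformly (fun k => migdal r (gs (φ k))) (migdal r g') atTop :=
      tendstoUniformly_migdal (fun k => hgs (φ k)) (hS₀ g' hg') hconv r
    have h2 : TendstoUniformly (fun k => migdal r (gs (φ k))) gn atTop := tendstoUniformly_subseq hlim hφ
    exact tendstoUniformly_unique h1 h2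
  -- a first subsequential limit `g`
  obtain ⟨ψ, hψ, g, hgS, hgconv⟩ := hnormal id strictMono_id
  refine ⟨g, hgS, hA hψ hgS hgconv, ?_⟩
  -- (ii): every subsequential limit equals `g`; hence the whole sequence converges
  by_contra hnot
  rw [Metric.tendstoUniformly_iff] at hnot
  push Not at hnot
  obtain ⟨ε, hε, hfreq⟩ := hnot
  obtain ⟨φ, hφ, hfar⟩ := extraction_of_frequently_atTop hfreq
  obtain ⟨ψ', hψ', g', hg'S, hg'conv⟩ := hnormal φ hφ
  have hgg' : g' = g := hinj hg'S hgS ((hA (hφ.comp hψ') hg'S hg'conv).trans (hA hψ hgS hgconv).symm)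
  rw [hgg', Metric.tendstoUniformly_iff] at hg'conv
  obtain ⟨k, hk⟩ := (hg'conv ε hε).exists
  obtain ⟨x, hx⟩ := hfar (ψ' k)
  exact (not_lt.mpr hx) (hk x)

end General

/-! ### §7. `G = SU(2)`: the display (2.4) for real `x` -/

section OnSU2

local notation "SU2" => Matrix.specialUnitaryGroup (Fin 2) ℂ

open HeatKernel (diagPhase diagPhase_add)

/-- **(2.4) for real `x`** on `G = SU(2)`: for a Gibbs factor `g` with (2.2)–(2.3) and `g′ = 𝒯g` (`r = 2`),
`g′(e^{−ixσ₃}u) = (1/𝒩){∫ dv g(e^{−(i/2)xσ₃}uv⁻¹) g(e^{−(i/2)xσ₃}v)}²` with `𝒩 = M² = (∫ [g(v)]² dv)²` — here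
`e^{−ixσ₃} = HeatKernel.diagPhase x` and `e^{−(i/2)xσ₃}e^{−(i/2)xσ₃} = e^{−ixσ₃}`. The paper continues the right side
analytically in `x` ((2.6)–(2.7), (3.1)); that continuation is not constructed here.
[cite: MullerSchiemann1987, (2.4) p.263, (2.6) p.264, (3.1) p.266] -/
theorem eq24_real {g : SU2 → ℝ} (hg : IsCentral g) (hs : IsSymm g) (x : ℝ) (u : SU2) :
    migdal 2 g (diagPhase x * u) =
      (1 / (∫ v, g v ^ 2 ∂(haarProbability SU2)) ^ 2) *
        (∫ v, g (diagPhase (x / 2) * u * v⁻¹) * g (diagPhase (x / 2) * v) ∂(haarProbability SU2)) ^ 2 := by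
  have hx : diagPhase x = diagPhase (x / 2) * diagPhase (x / 2) := by rw [← diagPhase_add]; ring_nf
  rw [hx, migdal_two_sq_mul hg hs, div_pow]
  ring

end OnSU2

end Migdal

end MullerSchiemann1987

end Literature.MathematicalPhysics.QuantumFieldTheory
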